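import Summits.ABC.IUTFork.DAGC312e
import Summits.ABC.IUTFork.Thm311Regions
import Summits.ABC.IUTFork.Cor312EdgeRegions
import Summits.ABC.IUTFork.ForkAbc

/-!
# Kernel DAG index — layer C312, part f: the loci read THROUGH THEOREM 3.11'S TYPED SITUATION, and the knitted apex (spec §2(e), §4 (3))

index v1 · abc-iut-c312-2 (filer) per HOME/plan/KERNEL-DAG-SPEC.md v1.3. APPEND-ONLY design as in `DAGC312e`: a new READING
of the 85 loci, nothing redefined.

THIS FILE PROVES NOTHING NEW AND ASSERTS NOTHING. `lociReadingM S pending` reads the Theorem-3.11 loci of the proof of Cor. 3.12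
AS abc-iut-c312-1's typed statements for a given lattice situation `S : Thm311.LatticeSituation T` (files B `Thm311Multirad`
p404064, C `Thm311LogKummer` p404703/p405020): Thm 3.11 (i)(b) ↦ "the splitting monoids sit in the sub-packets"
(`PsiInSubPackets` at every line), (i)(c) ↦ `DegreeClause`, (i) final portion ↦ `MultiradialCompat`, (ii)(a)/(b)/(c) ↦
`KummerA`/`KummerB`/`KummerC` of every column, (Ind3) ↦ `LatticeSituation.Ind3`, (ii) final portion ↦ `LogvolPrecise` of every
column, "the algorithm of Thm 3.11" ↦ `PartI ∧ PartII ∧ pending` ((iii) = file D, pending); (i)(a) and (Ind1), (Ind2) are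
DATA there (the packets `MRData`; `LogShells.Ind1/Ind2`) ↦ `True`; (iii)(a)–(d) stay `pending`; every other locus falls through
to `DAGC312e.lociReadingV2` (13 L6 nodes knitted, the rest `pending`). So 9 more loci are knitted (22 of 85), for the
situation at hand. `summit_of_cor312_M_knit` = `DAGTopM.summit_of_cor312_M_chain` with the loci hypothesis `hL` READ THROUGH
`lociReadingM (S P)`: granting the loci now literally means granting c312-1's typed Theorem 3.11 (i), (ii) for the curve's
situation (plus the knitted L6 node statements, plus the pending rest). HONEST FRAMING: nothing here asserts that abc is
proved or refuted or takes a side on Cor. 3.12. typed ≠ discharged; indexed ≠ endorsed. [claim: Mochizuki2012, status: disputed]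
-/

noncomputable section

namespace Summit.ABC.IUTFork.DAG

open Cor312Proof Thm311

/-- LOCI READING THROUGH THEOREM 3.11'S TYPED SITUATION (c312-1 B/C) on top of `lociReadingV2`. See the module docstring
for the arm-by-arm dictionary. [claim: Mochizuki2012, status: disputed] -/
def lociReadingM {T : ThetaIndex} (S : LatticeSituation T) (pending : Locus → Prop) (c : Locus) : Prop :=
  match c with
  | .thm3_11_i_a => True -- DATA: the tensor packets with their log-volumes = `S.D n : MRData` (Thm311Multirad)
  | .thm3_11_i_b => ∀ n : ℤ, (S.D n).PsiInSubPackets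
  | .thm3_11_i_c => S.DegreeClause
  | .thm3_11_i_perm => S.MultiradialCompat
  | .Ind1 => True -- DATA: `Thm311.LogShells.Ind1` (the indeterminacies themselves; "regarded up to" = `MultiradialCompat`)
  | .Ind2 => True -- DATA: `Thm311.LogShells.Ind2`
  | .Ind3 => S.Ind3
  | .thm3_11_ii_a => ∀ n : ℤ, (S.col n).KummerA (S.D n)
  | .thm3_11_ii_b => ∀ n : ℤ, (S.col n).KummerB (S.D n)
  | .thm3_11_ii_c => ∀ n : ℤ, (S.col n).KummerC (S.D n)
  | .thm3_11_ii_logvol => ∀ n : ℤ, (S.col n).LogvolPrecise (S.D n)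
  | .thm3_11_algo => S.PartI ∧ S.PartII ∧ pending .thm3_11_algo -- (iii): file D pending
  | c => lociReadingV2 pending c

variable {T : ThetaIndex} (S : LatticeSituation T) (pending : Locus → Prop)

/-- knitted: Thm 3.11 (i)(b) ↦ `PsiInSubPackets` at every line. [folklore] -/
theorem lociReadingM_thm3_11_i_b : lociReadingM S pending .thm3_11_i_b = ∀ n : ℤ, (S.D n).PsiInSubPackets := rfl
/-- knitted: Thm 3.11 (i)(c) ↦ `DegreeClause`. [folklore] -/
theorem lociReadingM_thm3_11_i_c : lociReadingM S pending .thm3_11_i_c = S.DegreeClause := rfl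
/-- knitted: Thm 3.11 (i) final portion ↦ `MultiradialCompat`. [folklore] -/
theorem lociReadingM_thm3_11_i_perm : lociReadingM S pending .thm3_11_i_perm = S.MultiradialCompat := rfl
/-- knitted: (Ind3) ↦ `LatticeSituation.Ind3`. [folklore] -/
theorem lociReadingM_Ind3 : lociReadingM S pending .Ind3 = S.Ind3 := rfl
/-- knitted: Thm 3.11 (ii)(a) ↦ `KummerA` of every column. [folklore] -/
theorem lociReadingM_thm3_11_ii_a : lociReadingM S pending .thm3_11_ii_a = ∀ n : ℤ, (S.col n).KummerA (S.D n) := rfl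
/-- knitted: Thm 3.11 (ii)(b) ↦ `KummerB` of every column. [folklore] -/
theorem lociReadingM_thm3_11_ii_b : lociReadingM S pending .thm3_11_ii_b = ∀ n : ℤ, (S.col n).KummerB (S.D n) := rfl
/-- knitted: Thm 3.11 (ii)(c) ↦ `KummerC` of every column. [folklore] -/
theorem lociReadingM_thm3_11_ii_c : lociReadingM S pending .thm3_11_ii_c = ∀ n : ℤ, (S.col n).KummerC (S.D n) := rfl
/-- knitted: Thm 3.11 (ii) final portion ↦ `LogvolPrecise` of every column. [folklore] -/
theorem lociReadingM_thm3_11_ii_logvol :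
    lociReadingM S pending .thm3_11_ii_logvol = ∀ n : ℤ, (S.col n).LogvolPrecise (S.D n) := rfl
/-- partly knitted: "the algorithm of Thm 3.11" ↦ `PartI ∧ PartII ∧ pending` ((iii) pending). [folklore] -/
theorem lociReadingM_thm3_11_algo :
    lociReadingM S pending .thm3_11_algo = (S.PartI ∧ S.PartII ∧ pending .thm3_11_algo) := rfl
/-- fall-through: every other locus is read as in `lociReadingV2` (e.g. (IPL) stays `pending`). [folklore] -/
theorem lociReadingM_IPL : lociReadingM S pending .IPL = pending .IPL := rfl
/-- fall-through to a V2-knitted L6 node (Rem 3.6.2 (i)). [folklore] -/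
theorem lociReadingM_rem3_6_2_i : lociReadingM S pending .rem3_6_2_i = lociReadingV2 pending .rem3_6_2_i := rfl

/-- **Granting Theorem 3.11 (i) and (ii) of the situation supplies the Thm-3.11 loci of the reading** (the rest being
granted through `pending` / the V2 nodes): if `S.PartI`, `S.PartII` and `∀ c, lociReadingV2 pending c` hold then every locus
is granted under `lociReadingM S pending`. Bookkeeping (`partII` unfolds to the column conjuncts). [folklore] -/
theorem lociReadingM_of_parts (hI : S.PartI) (hII : S.PartII) (hV2 : ∀ c, lociReadingV2 pending c) :
    ∀ c, lociReadingM S pending c := by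
  intro c
  unfold lociReadingM
  split
  · trivial
  · exact hI.1
  · exact hI.2.1
  · exact hI.2.2
  · trivial
  · trivial
  · exact S.ind3_of_partII hII
  · exact fun n => (hII n).1
  · exact fun n => (hII n).2.1
  · exact fun n => (hII n).2.2.1
  · exact fun n => (hII n).2.2.2.2.2
  · exact ⟨hI, hII, hV2 .thm3_11_algo⟩
  · exact hV2 _

/-- **APEX in the author's terms with the loci READ THROUGH THEOREM 3.11** (`DAGTopM.summit_of_cor312_M_chain` with
`L := lociReadingM (S P) pending` per curve): `ABC` from V, T, A, the multiradial estimate, per curve the typed situation and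
pilot nouns with admissibility and the two finiteness clauses, c312-1's typed Theorem 3.11 (i) and (ii) for that situation
(`hI`, `hII`), the V2-read remaining loci (`hV2`), the twenty printed inferences (`hC`), the (xi-f) sentence read as Reading 1
(`hread`), and the number identifications. kernel_hyps = 10. [claim: Mochizuki2012, status: disputed] -/
theorem summit_of_cor312_M_knit (V : HeightFamily) (Tm : Thm110Family V) (A : AbcDictionary V)
    (hInd : MochizukiIndeterminacies Tm) {TI : V.Pt → ThetaIndex} (S : ∀ P, LatticeSituation (TI P))
    (Pn : ∀ P, PilotNouns (S P)) (n m : ℤ)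
    (hadm : ∀ P (j : (TI P).LabelStar) (vQ : (TI P).VQ), (Pn P).ComponentAdm n m j vQ)
    (hreal : ∀ P, (Pn P).NegLogThetaReal n m) (hqreal : ∀ P, (Pn P).NegLogQReal n m)
    (pending : Locus → Prop) {O : Obs → Prop} (hI : ∀ P, (S P).PartI) (hII : ∀ P, (S P).PartII)
    (hV2 : ∀ c, lociReadingV2 pending c) (hC : ∀ P, Chain (lociReadingM (S P) pending) O)
    (hread : ∀ P (j : (TI P).LabelStar) (vQ : (TI P).VQ), O .constitutesConstruction →
      ((Pn P).toCor312Setting n m j vQ (hadm P j vQ)).RepresentedVol)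
    (hΘ : ∀ P, (Pn P).negLogTheta n m = (Tm.X P).negLogTheta) (hq : ∀ P, (Pn P).negLogQ n m = -(Tm.X P).absLogq) :
    _root_.ABC :=
  abc_of_indeterminacies_of_cor312 V Tm A hInd fun P => by
    have hc : (Pn P).Cor312At n m :=
      (Pn P).cor312At_of_componentwise n m (hadm P) (hreal P) (hqreal P)
        fun j vQ => setting_cor312_of_chain _ (lociReadingM_of_parts (S P) pending (hI P) (hII P) hV2) (hC P)
          (hread P j vQ)
    unfold Thm110Data.Cor312
    rw [← hΘ, ← hq]
    exact hc.2.2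

end Summit.ABC.IUTFork.DAG

end
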